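import Literature.Computability.AlgebraicComplexity.BorderRankExtensionSieveQuadratic
import Literature.Computability.AlgebraicComplexity.KoszulYoungCertificateMask
import HarnessLib

/-!
# The extension sieve, IV: arbitrary slack, every `(q, p)` — the `(s+1)`-minors of the new block

Topic `Literature/Computability/AlgebraicComplexity`; a trunk-independent TOOL continuing
`BorderRankExtension.lean` (lemma (E1)), `BorderRankExtensionSieve.lean` / `…Forced.lean` (a new slice
enters a Koszul–Young flattening through new COLUMNS / new ROWS; slack `0`: linear conditions) and
`…Quadratic.lean` (slack `1`: `2 × 2` minors), which were written for `q = 4`, `p = 1`.  Here: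

* **Any slack `s`** (`srcFlattening_minors`,
  `rowFlattening_minors`): if `bR(t + e_new ⊗ Z) ≤ r` and the old flattening of a role has rank
  `≥ C(q-1,p)·r - s`, then for any `s + 1` certified kernel vectors of the old matrix and any `s + 1`
  new indices, the `(s+1) × (s+1)` determinant of the values `L(y_α, S_β)(Z)` vanishes — by the rank
  bookkeeping `rank (Y·M') + rank (old block) ≤ rank M'` of part III.
* **Every `(q, p)` on codes** (`ClassSieve.srcMinor_eq_zero`, `ClassSieve.rowMinor_eq_zero`): the old
  matrix, the kernel vectors and the linear forms are presented on the bitmask codes of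
  `KoszulYoungCertificateMask.lean` (`KYMask.kyCode`, memoised), for a tensor
  `U ∈ ℤ^a ⊗ ℤ^q ⊗ ℤ^d` extended along the FIRST factor with the SECOND factor wedged (the other two
  arrangements are reached by transposing the last two factors at the call site); the integer
  coefficient of the linear form on a direction `C` is `srcLam` / `rowLam`, and
  `srcLamK_sum` / `rowLamK_sum` expand the form of `Z = ∑ y_i C_i` as `∑ y_i · srcLam(C_i)`.

These are the matrix-level facts behind the `macaulay` and `points` weight classes of the torus-fixed
refutation trees of the tight-`[4]^3` census (the polynomial identities in the class coordinates `y`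
are certified in the sequel).  HONEST FRAMING (pub-tensor bundle): a THEOREM-level tool for
CERTIFICATES about explicit small tensors, NOT progress on the exponent of matrix multiplication.

## References

* J. Jagiełła, J. Jelisiejew, *Unrestrictions and concise secant varieties*, arXiv:2604.24879 (2026),
  §1.4, Thm. 1.8, Thm. 2.2 [JagiellaJelisiejew2026Unrestrictions].
* J. M. Landsberg, G. Ottaviani, *New lower bounds for the border rank of matrix multiplication*,
  Theory of Computing 11 (2015), Thm. 2.1 [LandsbergOttaviani2015].
* J. M. Landsberg, *Geometry and complexity theory*, CUP 2017, §2.4.2 [LandsbergGCT2017].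
* M. Bläser, *Fast Matrix Multiplication*, Theory of Computing Graduate Surveys 5 (2013), §5.1
  [Blaser2013].
-/

open scoped BigOperators Matrix
open Matrix

namespace Literature.Computability.AlgebraicComplexity

open Literature.LinearAlgebra.Matrix

universe u

/-! ## A. Minors of a matrix of small rank: `Literature.LinearAlgebra.Matrix.det_submatrix_eq_zero_of_rank_lt_card` (RankMinors) -/

/-! ## B. The `(s+1)`-minors of the new block vanish (matrix level) -/

section Roles

variable {K : Type u} [Field K] {ι κ μ : Type} [Fintype κ] [Fintype ι] [Fintype μ] [DecidableEq ι]
  [DecidableEq κ] [DecidableEq μ]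

/-- **SOURCE role, slack `s`.** If `bR(extendSlice t Z) ≤ r`, the old matrix has rank
`≥ C(q-1,p)·r - s`, and `Y_0, …, Y_s` are left-kernel vectors of the old matrix, then for any new
columns `S_0, …, S_s` the determinant of the values
`f(Y_u, S_v) = ∑_{(T,c)} Y_u(T,c) · ∑_j (∑_x ε(T,S_v,x) M_{xj}) · Z_{jc}` vanishes.
[cite: LandsbergOttaviani2015, Thm 2.1] [cite: JagiellaJelisiejew2026Unrestrictions, Thm. 2.2 (use of the extension)] -/
theorem srcFlattening_minors (q p : ℕ) (M : Matrix (Fin q) κ K) (t : ι → κ → μ → K)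
    (Z : κ → μ → K) {r s : ℕ} (hZ : algBorderRank (extendSlice t Z) ≤ r)
    (hcap : (q - 1).choose p * r ≤ (srcFlattening q p M t).rank + s)
    (Y : Fin (s + 1) → PSub q (p + 1) × μ → K) (hY : ∀ u, Y u ᵥ* srcFlattening q p M t = 0)
    (S : Fin (s + 1) → PSub q p) :
    (Matrix.of fun u v => ∑ rr : PSub q (p + 1) × μ,
        Y u rr * ∑ j, (∑ x, (wedgeInc rr.1.1 (S v).1 x : K) * M x j) * Z j rr.2).det = 0 := by
  classical
  have hrank : (srcFlattening q p M (extendSlice t Z)).rank ≤ (q - 1).choose p * r :=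
    (rank_srcFlattening_le q p M (extendSlice t Z)).trans (Nat.mul_le_mul_left _ hZ)
  have hsub := srcFlattening_extendSlice_submatrix q p M t Z
  have hYM : Matrix.of Y * (srcFlattening q p M (extendSlice t Z)).submatrix id
      (fun x : PSub q p × ι => (x.1, some x.2)) = 0 := by
    rw [hsub]
    ext u col
    have h := congr_fun (hY u) col
    simpa [Matrix.mul_apply, Matrix.vecMul, dotProduct] using h
  have hbk := rank_mul_add_rank_submatrix_le (Matrix.of Y) _ _ hYM
  rw [hsub] at hbk
  have hN : (Matrix.of Y * srcFlattening q p M (extendSlice t Z)).rank ≤ s := by omega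
  have hdet := det_submatrix_eq_zero_of_rank_lt_card
    (Matrix.of Y * srcFlattening q p M (extendSlice t Z)) id (fun v => ((S v), (none : Option ι)))
    (by rw [Fintype.card_fin]; omega)
  rw [← hdet]
  congr 1
  ext u v
  simp only [Matrix.submatrix_apply, Matrix.of_apply, Matrix.mul_apply, id,
    srcFlattening_extendSlice_none]

/-- **ROW role, slack `s`.** The same with right-kernel vectors `X_0, …, X_s` of the old matrix and
new rows `T_0, …, T_s`: the determinant of
`g(T_u, X_v) = ∑_{(S,m)} X_v(S,m) · ∑_k (∑_x ε(T_u,S,x) M_{xk}) · Z_{km}` vanishes.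
[cite: LandsbergOttaviani2015, Thm 2.1] [cite: JagiellaJelisiejew2026Unrestrictions, Thm. 2.2 (use of the extension)] -/
theorem rowFlattening_minors (q p : ℕ) (M : Matrix (Fin q) κ K) (t : ι → κ → μ → K)
    (Z : κ → μ → K) {r s : ℕ} (hZ : algBorderRank (extendSlice t Z) ≤ r)
    (hcap : (q - 1).choose p * r ≤ (rowFlattening q p M t).rank + s)
    (X : Fin (s + 1) → PSub q p × μ → K) (hX : ∀ v, rowFlattening q p M t *ᵥ X v = 0)
    (T : Fin (s + 1) → PSub q (p + 1)) :
    (Matrix.of fun u v => ∑ cc : PSub q p × μ,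
        X v cc * ∑ k, (∑ x, (wedgeInc (T u).1 cc.1.1 x : K) * M x k) * Z k cc.2).det = 0 := by
  classical
  have hrank : (rowFlattening q p M (extendSlice t Z)).rank ≤ (q - 1).choose p * r :=
    (rank_rowFlattening_le q p M (extendSlice t Z)).trans (Nat.mul_le_mul_left _ hZ)
  have hsub := rowFlattening_extendSlice_submatrix q p M t Z
  have hMX : (rowFlattening q p M (extendSlice t Z)).submatrix
      (fun x : PSub q (p + 1) × ι => (x.1, some x.2)) id * (Matrix.of fun cc v => X v cc) = 0 := by
    rw [hsub]
    ext row v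
    have h := congr_fun (hX v) row
    simpa [Matrix.mul_apply, Matrix.mulVec, dotProduct] using h
  have hbk := rank_mul_add_rank_submatrix_le' _ (Matrix.of fun cc v => X v cc) _ hMX
  rw [hsub] at hbk
  have hN : (rowFlattening q p M (extendSlice t Z) * Matrix.of fun cc v => X v cc).rank ≤ s := by
    omega
  have hdet := det_submatrix_eq_zero_of_rank_lt_card
    (rowFlattening q p M (extendSlice t Z) * Matrix.of fun cc v => X v cc)
    (fun u => ((T u), (none : Option ι))) id (by rw [Fintype.card_fin]; omega)
  rw [← hdet]
  congr 1
  ext u v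
  simp only [Matrix.submatrix_apply, Matrix.of_apply, Matrix.mul_apply, id,
    rowFlattening_extendSlice_none]
  exact Finset.sum_congr rfl fun cc _ => mul_comm _ _

end Roles

/-! ## C. On codes, every `(q, p)`: tensor `U ∈ ℤ^a ⊗ ℤ^q ⊗ ℤ^d`, first factor extended, second wedged -/

namespace ClassSieve

open KYCert KYGen KYMask

section Codes

variable (q p : ℕ) [NeZero q]

/-- The `(p+1)`-subset numbered `τ` (default `dT` if the code is invalid). [folklore] -/
def tDec (dT : PSub q (p + 1)) (τ : ℕ) : PSub q (p + 1) :=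
  if h : (maskSet q ((validMasks q (p + 1)).getD τ 0)).card = p + 1
    then ⟨maskSet q ((validMasks q (p + 1)).getD τ 0), h⟩ else dT

/-- The `p`-subset numbered `β` (default `dS` if the code is invalid). [folklore] -/
def sDec (dS : PSub q p) (β : ℕ) : PSub q p :=
  if h : (maskSet q ((validMasks q p).getD β 0)).card = p
    then ⟨maskSet q ((validMasks q p).getD β 0), h⟩ else dS

omit [NeZero q] in
/-- `rowDec` in terms of `tDec`. [folklore] -/
theorem rowDec_eq (c : ℕ) [NeZero c] (dT : PSub q (p + 1)) (ρ : ℕ) :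
    rowDec q p c dT ρ = (tDec q p dT (ρ / c), finCode c ρ) := rfl

omit [NeZero q] in
/-- `colDec` in terms of `sDec`. [folklore] -/
theorem colDec_eq (b : ℕ) [NeZero b] (dS : PSub q p) (σ : ℕ) :
    colDec q p b dS σ = (sDec q p dS (σ / b), finCode b σ) := rfl

variable (a d : ℕ) [NeZero a] [NeZero d] (dT : PSub q (p + 1)) (dS : PSub q p)
  (U : Fin a → Fin q → Fin d → ℤ)

/-- Row decoder of the SOURCE-role matrix (rows `(T, l)`, `l : Fin d`), codes reduced. [folklore] -/
def srcRDec (ρ : ℕ) : PSub q (p + 1) × Fin d := rowDec q p d dT (ρ % nRows q p d)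

/-- Column decoder of the SOURCE-role matrix (columns `(S, i)`, `i : Fin a`), codes reduced. [folklore] -/
def srcCDec (σ : ℕ) : PSub q p × Fin a := colDec q p a dS (σ % nCols q p a)

/-- The old SOURCE-role matrix on codes: `T_{K^q}^{∧p}` of `(j, i, l) ↦ U i j l` (memoised).
[cite: LandsbergGCT2017, §2.4.2 (2.4.6)] -/
def srcMat (ρ σ : ℕ) : ℤ := kyCode q p a d dT dS (fun j i l => U i j l) ρ σ

/-- A left-kernel vector of the old source-role matrix, on row codes, certified on codes. [folklore] -/
def srcKvOk (kv : List (ℕ × ℤ)) : Bool :=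
  (List.range (nCols q p a)).all fun σ =>
    (kv.map fun rc => rc.2 * srcMat q p a d dT dS U rc.1 σ).sum == 0

/-- The integer coefficient `L(y, S_β)(C)` of the source-role linear form on a direction `C`:
`∑_{(ρ,λ) ∈ y} λ · ∑_x ε(T_ρ, S_β, x) · C(x, l_ρ)`. [cite: LandsbergOttaviani2015, Thm 2.1] -/
def srcLam (kv : List (ℕ × ℤ)) (β : ℕ) (C : Fin q → Fin d → ℤ) : ℤ :=
  (kv.map fun rc => rc.2 * lsum q fun x =>
    wedgeInc (srcRDec q p d dT rc.1).1.1 (sDec q p dS β).1 (finCode q x) *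
      C (finCode q x) (srcRDec q p d dT rc.1).2).sum

/-- Row decoder of the ROW-role matrix (rows `(T, i)`, `i : Fin a`), codes reduced. [folklore] -/
def rowRDec (ρ : ℕ) : PSub q (p + 1) × Fin a := rowDec q p a dT (ρ % nRows q p a)

/-- Column decoder of the ROW-role matrix (columns `(S, l)`, `l : Fin d`), codes reduced. [folklore] -/
def rowCDec (σ : ℕ) : PSub q p × Fin d := colDec q p d dS (σ % nCols q p d)

/-- The old ROW-role matrix on codes: `T_{K^q}^{∧p}` of `(j, l, i) ↦ U i j l` (memoised).
[cite: LandsbergGCT2017, §2.4.2 (2.4.6)] -/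
def rowMat (ρ σ : ℕ) : ℤ := kyCode q p d a dT dS (fun j l i => U i j l) ρ σ

/-- A right-kernel vector of the old row-role matrix, on column codes, certified on codes. [folklore] -/
def rowKvOk (kv : List (ℕ × ℤ)) : Bool :=
  (List.range (nRows q p a)).all fun ρ =>
    (kv.map fun rc => rc.2 * rowMat q p a d dT dS U ρ rc.1).sum == 0

/-- The integer coefficient `L(T_τ, x)(C)` of the row-role linear form on a direction `C`:
`∑_{(σ,λ) ∈ x} λ · ∑_x' ε(T_τ, S_σ, x') · C(x', l_σ)`. [cite: LandsbergOttaviani2015, Thm 2.1] -/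
def rowLam (kv : List (ℕ × ℤ)) (τ : ℕ) (C : Fin q → Fin d → ℤ) : ℤ :=
  (kv.map fun rc => rc.2 * lsum q fun x =>
    wedgeInc (tDec q p dT τ).1 (rowCDec q p d dS rc.1).1.1 (finCode q x) *
      C (finCode q x) (rowCDec q p d dS rc.1).2).sum

/-- Every `p`-subset (resp. `(p+1)`-subset) is a numbered bitmask — decided per `(q, p)` by `decide`.
[folklore] -/
def subsetsOk : Bool :=
  decide (∀ S : PSub q p, ∃ u < (validMasks q p).length,
      maskSet q ((validMasks q p).getD u 0) = S.1) &&
    decide (∀ T : PSub q (p + 1), ∃ u < (validMasks q (p + 1)).length,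
      maskSet q ((validMasks q (p + 1)).getD u 0) = T.1)

/-- SOURCE role check: subsets numbered, `n` certified independent rows of the old matrix with
`C(q-1,p)·r ≤ n + s`. [cite: LandsbergOttaviani2015, Thm 2.1] -/
def srcRoleOk (r s n : ℕ) (rows : List (List (ℕ × ℤ))) (piv : List ℕ) : Bool :=
  subsetsOk q p && kyCheck q p a d dT dS (fun j i l => U i j l) n rows piv &&
    decide ((q - 1).choose p * r ≤ n + s)

/-- ROW role check. [cite: LandsbergOttaviani2015, Thm 2.1] -/
def rowRoleOk (r s n : ℕ) (rows : List (List (ℕ × ℤ))) (piv : List ℕ) : Bool :=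
  subsetsOk q p && kyCheck q p d a dT dS (fun j l i => U i j l) n rows piv &&
    decide ((q - 1).choose p * r ≤ n + s)

end Codes

/-! ### Soundness -/

section Sound

variable {K : Type u} [Field K]

variable (q p : ℕ) [NeZero q] (a d : ℕ) [NeZero a] [NeZero d] (dT : PSub q (p + 1)) (dS : PSub q p)
  (U : Fin a → Fin q → Fin d → ℤ)

/-- The source-role linear form over `K` of a kernel vector on codes and a new column `β`, at `Z`.
[cite: LandsbergOttaviani2015, Thm 2.1] -/
def srcLamK (kv : List (ℕ × ℤ)) (β : ℕ) (Z : Fin q → Fin d → K) : K :=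
  (kv.map fun rc => (rc.2 : K) * ∑ x : Fin q,
    (wedgeInc (srcRDec q p d dT rc.1).1.1 (sDec q p dS β).1 x : K) * Z x (srcRDec q p d dT rc.1).2).sum

/-- The row-role linear form over `K`. [cite: LandsbergOttaviani2015, Thm 2.1] -/
def rowLamK (kv : List (ℕ × ℤ)) (τ : ℕ) (Z : Fin q → Fin d → K) : K :=
  (kv.map fun rc => (rc.2 : K) * ∑ x : Fin q,
    (wedgeInc (tDec q p dT τ).1 (rowCDec q p d dS rc.1).1.1 x : K) * Z x (rowCDec q p d dS rc.1).2).sum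

omit [NeZero a] in
/-- `srcLamK` is linear: on `Z = ∑_i y_i C_i` it is `∑_i y_i · srcLam(C_i)`. [folklore] -/
theorem srcLamK_sum {k : ℕ} (kv : List (ℕ × ℤ)) (β : ℕ) (C : Fin k → Fin q → Fin d → ℤ)
    (y : Fin k → K) :
    srcLamK (K := K) q p d dT dS kv β (fun x l => ∑ i, y i * (C i x l : K)) =
      ∑ i, y i * (srcLam q p d dT dS kv β (C i) : K) := by
  have hf : ∀ x : Fin q, finCode q (x : ℕ) = x := fun x => Fin.ext (Nat.mod_eq_of_lt x.isLt)
  induction kv with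
  | nil => simp [srcLamK, srcLam]
  | cons rc kv ih =>
    simp only [srcLamK, srcLam, List.map_cons, List.sum_cons] at ih ⊢
    rw [ih]
    simp only [Int.cast_add, Int.cast_mul, lsum_eq, Int.cast_sum, hf, mul_add, Finset.mul_sum,
      Finset.sum_add_distrib]
    congr 1
    rw [Finset.sum_comm]
    refine Finset.sum_congr rfl fun i _ => ?_
    refine Finset.sum_congr rfl fun x _ => ?_
    ring

omit [NeZero a] in
/-- `rowLamK` is linear. [folklore] -/
theorem rowLamK_sum {k : ℕ} (kv : List (ℕ × ℤ)) (τ : ℕ) (C : Fin k → Fin q → Fin d → ℤ)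
    (y : Fin k → K) :
    rowLamK (K := K) q p d dT dS kv τ (fun x l => ∑ i, y i * (C i x l : K)) =
      ∑ i, y i * (rowLam q p d dT dS kv τ (C i) : K) := by
  have hf : ∀ x : Fin q, finCode q (x : ℕ) = x := fun x => Fin.ext (Nat.mod_eq_of_lt x.isLt)
  induction kv with
  | nil => simp [rowLamK, rowLam]
  | cons rc kv ih =>
    simp only [rowLamK, rowLam, List.map_cons, List.sum_cons] at ih ⊢
    rw [ih]
    simp only [Int.cast_add, Int.cast_mul, lsum_eq, Int.cast_sum, hf, mul_add, Finset.mul_sum,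
      Finset.sum_add_distrib]
    congr 1
    rw [Finset.sum_comm]
    refine Finset.sum_congr rfl fun i _ => ?_
    refine Finset.sum_congr rfl fun x _ => ?_
    ring

omit [NeZero q] in
/-- The subsets check gives surjective column / row decoders. [folklore] -/
theorem exists_colDec_of_subsetsOk {b : ℕ} [NeZero b] (h : subsetsOk q p = true)
    (col : PSub q p × Fin b) : ∃ σ, σ < nCols q p b ∧ colDec q p b dS σ = col := by
  obtain ⟨S, i⟩ := col
  unfold subsetsOk at h
  simp only [Bool.and_eq_true, decide_eq_true_eq] at h
  obtain ⟨u, hu, hS⟩ := h.1 S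
  have hb : 0 < b := Nat.pos_of_ne_zero (NeZero.ne b)
  refine ⟨u * b + i, ?_, ?_⟩
  · unfold nCols
    calc u * b + i < u * b + b := by omega
      _ = (u + 1) * b := by ring
      _ ≤ (validMasks q p).length * b := Nat.mul_le_mul_right _ hu
  · have h1 : (u * b + i) / b = u := by
      rw [Nat.mul_comm, Nat.mul_add_div hb, Nat.div_eq_of_lt i.isLt, add_zero]
    have h3 : finCode b (u * b + i) = i := by
      refine Fin.ext ?_
      show (u * b + ↑i) % b = i
      rw [Nat.mul_comm, Nat.mul_add_mod, Nat.mod_eq_of_lt i.isLt]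
    rw [colDec_eq, h1, h3]
    have hc : (maskSet q ((validMasks q p).getD u 0)).card = p := by rw [hS]; exact S.2
    simp only [sDec, hc, dite_true]
    congr 1
    exact Subtype.ext hS

omit [NeZero q] in
/-- Row decoders are surjective under the subsets check. [folklore] -/
theorem exists_rowDec_of_subsetsOk {c : ℕ} [NeZero c] (h : subsetsOk q p = true)
    (row : PSub q (p + 1) × Fin c) : ∃ ρ, ρ < nRows q p c ∧ rowDec q p c dT ρ = row := by
  obtain ⟨T, i⟩ := row
  unfold subsetsOk at h
  simp only [Bool.and_eq_true, decide_eq_true_eq] at h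
  obtain ⟨u, hu, hT⟩ := h.2 T
  have hc : 0 < c := Nat.pos_of_ne_zero (NeZero.ne c)
  refine ⟨u * c + i, ?_, ?_⟩
  · unfold nRows
    calc u * c + i < u * c + c := by omega
      _ = (u + 1) * c := by ring
      _ ≤ (validMasks q (p + 1)).length * c := Nat.mul_le_mul_right _ hu
  · have h1 : (u * c + i) / c = u := by
      rw [Nat.mul_comm, Nat.mul_add_div hc, Nat.div_eq_of_lt i.isLt, add_zero]
    have h3 : finCode c (u * c + i) = i := by
      refine Fin.ext ?_
      show (u * c + ↑i) % c = i
      rw [Nat.mul_comm, Nat.mul_add_mod, Nat.mod_eq_of_lt i.isLt]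
    rw [rowDec_eq, h1, h3]
    have hc' : (maskSet q ((validMasks q (p + 1)).getD u 0)).card = p + 1 := by rw [hT]; exact T.2
    simp only [tDec, hc', dite_true]
    congr 1
    exact Subtype.ext hT

omit [NeZero q] in
/-- The integer `(q,p)` flattening with `Φ = id`, base-changed, is the flattening over `K` with `Φ = id`.
[folklore] -/
theorem koszulFlatteningGen_one_map {b c : ℕ} (t : Fin q → Fin b → Fin c → ℤ) :
    (koszulFlatteningGen q p (1 : Matrix (Fin q) (Fin q) ℤ).mulVecLin t).map (Int.cast : ℤ → K) =
      koszulFlatteningGen q p (1 : Matrix (Fin q) (Fin q) K).mulVecLin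
        (fun x j l => (t x j l : K)) := by
  have h : (koszulFlatteningGen q p (1 : Matrix (Fin q) (Fin q) ℤ).mulVecLin t).map (Int.cast : ℤ → K) =
      koszulFlatteningGen q p ((1 : Matrix (Fin q) (Fin q) ℤ).map (Int.cast : ℤ → K)).mulVecLin
        (fun x j l => (t x j l : K)) :=
    koszulFlatteningGen_mulVecLin_map q p (Int.castRingHom K) 1 t
  rw [h, Matrix.map_one (Int.cast : ℤ → K) Int.cast_zero Int.cast_one]

/-- What `kyCheck` certifies about the RANK (the first half of `le_algBorderRank_of_kyCheck`).
[cite: LandsbergOttaviani2015, Thm. 2.1] -/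
theorem le_rank_of_kyCheck {b c : ℕ} [NeZero b] [NeZero c] (T : Fin q → Fin b → Fin c → ℤ)
    {n : ℕ} {rows : List (List (ℕ × ℤ))} {piv : List ℕ}
    (h : kyCheck q p b c dT dS T n rows piv = true) :
    n ≤ (koszulFlatteningGen q p (1 : Matrix (Fin q) (Fin q) K).mulVecLin
      (fun x j l => (T x j l : K))).rank := by
  unfold kyCheck at h
  simp only [Bool.and_eq_true, decide_eq_true_eq] at h
  obtain ⟨⟨hR0, hC0⟩, h⟩ := h
  have e : kyCode q p b c dT dS T = fun ρ σ =>
      koszulFlatteningGen q p (1 : Matrix (Fin q) (Fin q) ℤ).mulVecLin T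
        (rowDec q p c dT (ρ % nRows q p c)) (colDec q p b dS (σ % nCols q p b)) :=
    funext fun ρ => funext fun σ => kyCode_eq q p b c dT dS T hR0 hC0 ρ σ
  rw [e] at h
  have hr := le_rank_of_intTriCheckUnit (F := K)
    (koszulFlatteningGen q p (1 : Matrix (Fin q) (Fin q) ℤ).mulVecLin T)
    (fun ρ => rowDec q p c dT (ρ % nRows q p c)) (fun σ => colDec q p b dS (σ % nCols q p b)) h
  rwa [koszulFlatteningGen_one_map] at hr

/-- The `kyCheck` code ranges are non-empty. [folklore] -/
theorem pos_of_kyCheck {b c : ℕ} [NeZero b] [NeZero c] (T : Fin q → Fin b → Fin c → ℤ)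
    {n : ℕ} {rows : List (List (ℕ × ℤ))} {piv : List ℕ}
    (h : kyCheck q p b c dT dS T n rows piv = true) : 0 < nRows q p c ∧ 0 < nCols q p b := by
  unfold kyCheck at h
  simp only [Bool.and_eq_true, decide_eq_true_eq] at h
  exact h.1

/-- The old source-role flattening over `K` is the `kyCode` matrix decoded. [folklore] -/
theorem srcFlattening_decoded (hR : 0 < nRows q p d) (hC : 0 < nCols q p a) (ρ σ : ℕ) :
    srcFlattening q p (1 : Matrix (Fin q) (Fin q) K) (fun i j l => (U i j l : K))
        (srcRDec q p d dT ρ) (srcCDec q p a dS σ) = (srcMat q p a d dT dS U ρ σ : K) := by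
  unfold srcMat srcRDec srcCDec srcFlattening
  rw [kyCode_eq q p a d dT dS _ hR hC]
  have h := koszulFlatteningGen_one_map (K := K) q p (fun j i l => U i j l)
  rw [← h, Matrix.map_apply]

/-- The old row-role flattening over `K` is the `kyCode` matrix decoded. [folklore] -/
theorem rowFlattening_decoded (hR : 0 < nRows q p a) (hC : 0 < nCols q p d) (ρ σ : ℕ) :
    rowFlattening q p (1 : Matrix (Fin q) (Fin q) K) (fun i j l => (U i j l : K))
        (rowRDec q p a dT ρ) (rowCDec q p d dS σ) = (rowMat q p a d dT dS U ρ σ : K) := by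
  unfold rowMat rowRDec rowCDec rowFlattening
  rw [kyCode_eq q p d a dT dS _ hR hC]
  have h := koszulFlatteningGen_one_map (K := K) q p (fun j l i => U i j l)
  rw [← h, Matrix.map_apply]

/-- A source-role kernel vector certified on codes kills the old matrix over `K`. [folklore] -/
theorem vecMul_srcFlattening_eq_zero (hsub : subsetsOk q p = true) (hR : 0 < nRows q p d)
    (hC : 0 < nCols q p a) (kv : List (ℕ × ℤ)) (h : srcKvOk q p a d dT dS U kv = true) :
    intCertRow (F := K) (srcRDec q p d dT) kv ᵥ*
      srcFlattening q p (1 : Matrix (Fin q) (Fin q) K) (fun i j l => (U i j l : K)) = 0 := by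
  classical
  funext col
  obtain ⟨σ, hσ, hcol⟩ := exists_colDec_of_subsetsOk q p dS hsub col
  have hcol' : srcCDec q p a dS σ = col := by
    unfold srcCDec; rwa [Nat.mod_eq_of_lt hσ]
  unfold srcKvOk at h
  rw [List.all_eq_true] at h
  have h' := h σ (List.mem_range.2 hσ)
  simp only [beq_iff_eq] at h'
  simp only [Matrix.vecMul, dotProduct, Pi.zero_apply]
  rw [← hcol', sum_intCertRow_mul' (srcRDec q p d dT) _ kv]
  simp only [srcFlattening_decoded q p a d dT dS U hR hC]
  have : (kv.map fun rc => (rc.2 : K) * (srcMat q p a d dT dS U rc.1 σ : K)) =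
      (kv.map fun rc => rc.2 * srcMat q p a d dT dS U rc.1 σ).map (Int.cast : ℤ → K) := by
    simp [List.map_map, Function.comp_def]
  rw [this, ← Int.cast_list_sum, h', Int.cast_zero]

/-- A row-role kernel vector certified on codes is killed by the old matrix over `K`. [folklore] -/
theorem rowFlattening_mulVec_eq_zero (hsub : subsetsOk q p = true) (hR : 0 < nRows q p a)
    (hC : 0 < nCols q p d) (kv : List (ℕ × ℤ)) (h : rowKvOk q p a d dT dS U kv = true) :
    rowFlattening q p (1 : Matrix (Fin q) (Fin q) K) (fun i j l => (U i j l : K)) *ᵥ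
      intCertRow (F := K) (rowCDec q p d dS) kv = 0 := by
  classical
  funext row
  obtain ⟨ρ, hρ, hrow⟩ := exists_rowDec_of_subsetsOk q p dT hsub row
  have hrow' : rowRDec q p a dT ρ = row := by
    unfold rowRDec; rwa [Nat.mod_eq_of_lt hρ]
  unfold rowKvOk at h
  rw [List.all_eq_true] at h
  have h' := h ρ (List.mem_range.2 hρ)
  simp only [beq_iff_eq] at h'
  simp only [Matrix.mulVec, dotProduct, Pi.zero_apply]
  rw [← hrow']
  have e : ∑ x, rowFlattening q p (1 : Matrix (Fin q) (Fin q) K) (fun i j l => (U i j l : K))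
      (rowRDec q p a dT ρ) x * intCertRow (F := K) (rowCDec q p d dS) kv x =
      ∑ x, intCertRow (F := K) (rowCDec q p d dS) kv x * rowFlattening q p
        (1 : Matrix (Fin q) (Fin q) K) (fun i j l => (U i j l : K)) (rowRDec q p a dT ρ) x :=
    Finset.sum_congr rfl fun x _ => mul_comm _ _
  rw [e, sum_intCertRow_mul' (rowCDec q p d dS) _ kv]
  simp only [rowFlattening_decoded q p a d dT dS U hR hC]
  have : (kv.map fun rc => (rc.2 : K) * (rowMat q p a d dT dS U ρ rc.1 : K)) =
      (kv.map fun rc => rc.2 * rowMat q p a d dT dS U ρ rc.1).map (Int.cast : ℤ → K) := by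
    simp [List.map_map, Function.comp_def]
  rw [this, ← Int.cast_list_sum, h', Int.cast_zero]

/-- **Source-role minors on codes.** If the source role passes its check with slack `s`, `Y_0 … Y_s`
are certified kernel vectors and `β_0 … β_s` new columns, then for every `Z` with
`bR(U ⊗ K + e_new ⊗ Z) ≤ r`: `det [ L(Y_u, S_{β_v})(Z) ]_{u,v} = 0`.
[cite: LandsbergOttaviani2015, Thm 2.1] [cite: JagiellaJelisiejew2026Unrestrictions, Thm. 2.2] -/
theorem srcMinor_eq_zero {r s n : ℕ} {rows : List (List (ℕ × ℤ))} {piv : List ℕ}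
    (hrole : srcRoleOk q p a d dT dS U r s n rows piv = true) (kvs : Fin (s + 1) → List (ℕ × ℤ))
    (hkv : ∀ u, srcKvOk q p a d dT dS U (kvs u) = true) (βs : Fin (s + 1) → ℕ)
    (Z : Fin q → Fin d → K) (hZ : algBorderRank (extendSlice (fun i j l => (U i j l : K)) Z) ≤ r) :
    (Matrix.of fun u v => srcLamK (K := K) q p d dT dS (kvs u) (βs v) Z).det = 0 := by
  classical
  unfold srcRoleOk at hrole
  simp only [Bool.and_eq_true, decide_eq_true_eq] at hrole
  obtain ⟨⟨hsub, hky⟩, hns⟩ := hrole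
  obtain ⟨hR, hC⟩ := pos_of_kyCheck q p dT dS _ hky
  have hrank := le_rank_of_kyCheck (K := K) q p dT dS _ hky
  have hcap : (q - 1).choose p * r ≤ (srcFlattening q p (1 : Matrix (Fin q) (Fin q) K)
      (fun i j l => (U i j l : K))).rank + s := hns.trans (Nat.add_le_add_right hrank s)
  have key := srcFlattening_minors q p (1 : Matrix (Fin q) (Fin q) K) (fun i j l => (U i j l : K))
    Z hZ hcap (fun u => intCertRow (F := K) (srcRDec q p d dT) (kvs u))
    (fun u => vecMul_srcFlattening_eq_zero q p a d dT dS U hsub hR hC (kvs u) (hkv u))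
    (fun v => sDec q p dS (βs v))
  rw [← key]
  congr 1
  ext u v
  simp only [Matrix.of_apply, srcLamK]
  rw [sum_intCertRow_mul' (srcRDec q p d dT) _ (kvs u)]
  congr 1
  refine List.map_congr_left fun rc _ => ?_
  congr 1
  simp only [Matrix.one_apply, mul_ite, mul_one, mul_zero, Finset.sum_ite_eq', Finset.mem_univ,
    if_true]

/-- **Row-role minors on codes.** [cite: LandsbergOttaviani2015, Thm 2.1] [cite: JagiellaJelisiejew2026Unrestrictions, Thm. 2.2] -/
theorem rowMinor_eq_zero {r s n : ℕ} {rows : List (List (ℕ × ℤ))} {piv : List ℕ}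
    (hrole : rowRoleOk q p a d dT dS U r s n rows piv = true) (kvs : Fin (s + 1) → List (ℕ × ℤ))
    (hkv : ∀ v, rowKvOk q p a d dT dS U (kvs v) = true) (τs : Fin (s + 1) → ℕ)
    (Z : Fin q → Fin d → K) (hZ : algBorderRank (extendSlice (fun i j l => (U i j l : K)) Z) ≤ r) :
    (Matrix.of fun u v => rowLamK (K := K) q p d dT dS (kvs v) (τs u) Z).det = 0 := by
  classical
  unfold rowRoleOk at hrole
  simp only [Bool.and_eq_true, decide_eq_true_eq] at hrole
  obtain ⟨⟨hsub, hky⟩, hns⟩ := hrole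
  obtain ⟨hR, hC⟩ := pos_of_kyCheck q p dT dS _ hky
  have hrank := le_rank_of_kyCheck (K := K) q p dT dS _ hky
  have hcap : (q - 1).choose p * r ≤ (rowFlattening q p (1 : Matrix (Fin q) (Fin q) K)
      (fun i j l => (U i j l : K))).rank + s := hns.trans (Nat.add_le_add_right hrank s)
  have key := rowFlattening_minors q p (1 : Matrix (Fin q) (Fin q) K) (fun i j l => (U i j l : K))
    Z hZ hcap (fun v => intCertRow (F := K) (rowCDec q p d dS) (kvs v))
    (fun v => rowFlattening_mulVec_eq_zero q p a d dT dS U hsub hR hC (kvs v) (hkv v))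
    (fun u => tDec q p dT (τs u))
  rw [← key]
  congr 1
  ext u v
  simp only [Matrix.of_apply, rowLamK]
  rw [sum_intCertRow_mul' (rowCDec q p d dS) _ (kvs v)]
  congr 1
  refine List.map_congr_left fun rc _ => ?_
  congr 1
  simp only [Matrix.one_apply, mul_ite, mul_one, mul_zero, Finset.sum_ite_eq', Finset.mem_univ,
    if_true]

end Sound

end ClassSieve

end Literature.Computability.AlgebraicComplexity
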